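import Literature.Topology.FourManifolds.IsotopyExtensionSupport
import Literature.Topology.FourManifolds.ImmersionCriterion
import Literature.Topology.FourManifolds.EquidimensionalEmbedding
import Literature.Topology.FourManifolds.InteriorDiscs
import HarnessLib

/-!
# Sweeping one round circle of a planar chart onto another by an ambient isotopy of a closed surface

Topic `Literature/Topology/FourManifolds`; a corollary of the isotopy extension theorem with
support control (`exists_ambientIsotopy_comp_eq_of_subset`, `IsotopyExtensionSupport.lean`:
Milnor 1965, Thm. 5.8; Hirsch 1976, Ch. 8 §1, Thm. 1.3) for the simplest isotopy of circles.
**Everything here is proved; no definition and no named fact is introduced.**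

Let `N` be a closed smooth surface (compact, Hausdorff, modelled on `ℝ²`) and `ψ : ℝ² → N` a
smooth embedding of the plane (a *disc* of `N`).  For radii `0 < r₀, r₁ < R` and
`r' < min r₀ r₁` (e.g. `r' = 0`: then `B̄(0, r') = {0}`; `r' < 0`: no inner hole):

* `isSmoothEmbedding_disc_comp_smul_sphere` — each round circle `x ↦ ψ (c • x)`, `c ≠ 0`, is a
  smoothly embedded circle of `N`;
* `exists_ambientIsotopy_sweep_circle` — **there is an ambient isotopy `Ψ` of `N` with
  `Ψ₁ (ψ (r₀ • x)) = ψ (r₁ • x)` for all unit vectors `x`, all of whose stages are the identity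
  off the open annular region `ψ (B(0, R) ∖ B̄(0, r'))`** (so `Ψ` neither moves the points of `N`
  off the disc `ψ(B(0, R))` nor the small disc `ψ(B̄(0, r'))`).  The isotopy of embedded circles
  `t ↦ (x ↦ ψ (ρ(t) • x))`, `ρ(t) = r₀ + (r₁ - r₀) smoothTransition t`, runs inside that open
  set, and the isotopy extension theorem with support does the rest.

* `isSmoothEmbedding_comp_smul_sphere_of_annulus`,
  `exists_ambientIsotopy_sweep_circle_of_annulus` — the same for a plane map `ψ` that is only an
  injective immersion, smoothly, on an open round annulus `{r_lo < ‖x‖ < r_hi}` (an annular chart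
  through a punctured plane), with the support of the sweep inside any open `O ⊇ ψ{r' < ‖x‖ < R}`.

Combined with the smooth annulus theorem in the plane (`SchoenfliesPlane.exists_annulus`,
`SchoenfliesAnnulus.lean`: the closed region between two nested smooth Jordan curves of a planar
chart is `e({1 ≤ ‖x‖ ≤ 2})` for a smooth embedding `e` of the plane) this gives the **sweep
move**: an ambient isotopy of the surface, supported near the region between the two curves,
carrying one curve onto the other — e.g. a meridian circle of a level surface of a handlebody
swept across a planar region onto the curve produced by a wave (Hensel (2020), §5; the
"Torelli" half of Griffiths' theorem, `HandlebodyKernelExtensionTorelli.lean`).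

## References

* J. Milnor, *Lectures on the h-cobordism theorem* (1965), Thm. 5.8. [MilnorHCobordism1965]
* M. W. Hirsch, *Differential Topology*, GTM 33 (1976), Ch. 8 §1, Thm. 1.3. [HirschDT1976]
* S. Hensel, *A primer on handlebody groups* (2020), §5. [Hensel2020HandlebodyPrimer]
-/

open scoped Manifold ContDiff Topology
open Set Function Metric Module

noncomputable section

namespace Literature.Topology.FourManifolds

namespace SurfaceCircleSweep

variable {N : Type*} [TopologicalSpace N] [ChartedSpace (EuclideanSpace ℝ (Fin 2)) N]
  [IsManifold (𝓡 2) ∞ N] [T2Space N]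

/-- **A round circle of a planar disc is a smoothly embedded circle of the surface**: for a
smooth embedding `ψ : ℝ² → N` and `c ≠ 0`, `x ↦ ψ (c • x)` is a smooth embedding `𝕊¹ → N`
(immersion criterion on the compact circle: `dψ`, `c • id` and the differential of `𝕊¹ ⊆ ℝ²`
are injective). [folklore] -/
theorem isSmoothEmbedding_disc_comp_smul_sphere {ψ : EuclideanSpace ℝ (Fin 2) → N}
    (hψ : Manifold.IsSmoothEmbedding (𝓡 2) (𝓡 2) ∞ ψ) {c : ℝ} (hc : c ≠ 0) :
    Manifold.IsSmoothEmbedding (𝓡 1) (𝓡 2) ∞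
      (fun x : sphere (0 : EuclideanSpace ℝ (Fin (1 + 1))) 1 =>
        ψ (c • (x : EuclideanSpace ℝ (Fin 2)))) := by
  haveI : Fact (finrank ℝ (EuclideanSpace ℝ (Fin (1 + 1))) = 1 + 1) := ⟨finrank_euclideanSpace_fin⟩
  set L : EuclideanSpace ℝ (Fin 2) ≃L[ℝ] EuclideanSpace ℝ (Fin 2) :=
    ContinuousLinearEquiv.smulLeft (Units.mk0 c hc) with hL_def
  have hL : ∀ y : EuclideanSpace ℝ (Fin 2), L y = c • y := fun y => by
    rw [hL_def, ContinuousLinearEquiv.smulLeft_apply_apply, Units.smul_mk0]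
  have hcoe : ContMDiff (𝓡 1) (𝓡 2) ∞
      ((↑) : sphere (0 : EuclideanSpace ℝ (Fin (1 + 1))) 1 → EuclideanSpace ℝ (Fin 2)) :=
    contMDiff_coe_sphere
  have hLc : ContMDiff (𝓡 2) (𝓡 2) ∞ (L : EuclideanSpace ℝ (Fin 2) → EuclideanSpace ℝ (Fin 2)) :=
    (L : EuclideanSpace ℝ (Fin 2) →L[ℝ] EuclideanSpace ℝ (Fin 2)).contMDiff
  have heq : (fun x : sphere (0 : EuclideanSpace ℝ (Fin (1 + 1))) 1 =>
      ψ (c • (x : EuclideanSpace ℝ (Fin 2)))) = ψ ∘ (L ∘ (↑)) := by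
    funext x
    simp only [Function.comp_apply, hL]
  rw [heq]
  have hc' : ContMDiff (𝓡 1) (𝓡 2) ∞ (ψ ∘ (L ∘ (↑)) :
      sphere (0 : EuclideanSpace ℝ (Fin (1 + 1))) 1 → N) :=
    hψ.contMDiff.comp (hLc.comp hcoe)
  refine isSmoothEmbedding_of_injective_of_injective_mfderiv hc' (by exact_mod_cast le_top)
    (hψ.isEmbedding.injective.comp (L.injective.comp Subtype.val_injective)) fun x => ?_
  have h1 : MDifferentiableAt (𝓡 1) (𝓡 2)
      ((↑) : sphere (0 : EuclideanSpace ℝ (Fin (1 + 1))) 1 → EuclideanSpace ℝ (Fin 2)) x :=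
    (hcoe x).mdifferentiableAt (by simp)
  have h2 : MDifferentiableAt (𝓡 2) (𝓡 2) (L : EuclideanSpace ℝ (Fin 2) → EuclideanSpace ℝ (Fin 2))
      (x : EuclideanSpace ℝ (Fin 2)) := (hLc _).mdifferentiableAt (by simp)
  have h12 : MDifferentiableAt (𝓡 1) (𝓡 2)
      (L ∘ (↑) : sphere (0 : EuclideanSpace ℝ (Fin (1 + 1))) 1 → EuclideanSpace ℝ (Fin 2)) x :=
    h2.comp x h1
  have h3 : MDifferentiableAt (𝓡 2) (𝓡 2) ψ (L (x : EuclideanSpace ℝ (Fin 2))) :=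
    (hψ.contMDiff _).mdifferentiableAt (by simp)
  rw [mfderiv_comp x h3 h12, mfderiv_comp x h2 h1, ContinuousLinearEquiv.mfderiv_eq]
  have hinjψ : Injective (mfderiv (𝓡 2) (𝓡 2) ψ (L (x : EuclideanSpace ℝ (Fin 2)))) :=
    (((hψ.isLocalDiffeomorph_of_finrank_eq rfl) _).mfderivToContinuousLinearEquiv
      (by simp)).injective
  exact hinjψ.comp (L.injective.comp (mfderiv_coe_sphere_injective (n := 1) x))

variable [CompactSpace N]

/-- **Sweeping one round circle of a planar chart onto another.**  Let `N` be a closed surface,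
`ψ : ℝ² → N` a smooth embedding of the plane, `0 < r₀ < R`, `0 < r₁ < R` and
`r' < min r₀ r₁`.  Then there is an ambient isotopy `Ψ` of `N` with
`Ψ₁ (ψ (r₀ • x)) = ψ (r₁ • x)` for every unit vector `x`, and `Ψ_t y = y` for all `t` and all
`y ∉ ψ (B(0, R) ∖ B̄(0, r'))`.  (The isotopy of circles `x ↦ ψ (ρ t • x)`,
`ρ t = r₀ + (r₁ - r₀) smoothTransition t`, lies in that open set; isotopy extension with
support, Milnor Thm. 5.8 / Hirsch Ch. 8 §1 Thm. 1.3.)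
[cite: MilnorHCobordism1965, Thm. 5.8 (PDF p. 34)] [cite: HirschDT1976, Ch. 8 §1, Thm. 1.3] -/
theorem exists_ambientIsotopy_sweep_circle {ψ : EuclideanSpace ℝ (Fin 2) → N}
    (hψ : Manifold.IsSmoothEmbedding (𝓡 2) (𝓡 2) ∞ ψ) {r₀ r₁ R r' : ℝ}
    (h₀ : 0 < r₀) (h₁ : 0 < r₁) (hR₀ : r₀ < R) (hR₁ : r₁ < R)
    (hr'₀ : r' < r₀) (hr'₁ : r' < r₁) :
    ∃ Ψ : AmbientIsotopy (𝓡 2) N,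
      (∀ x : sphere (0 : EuclideanSpace ℝ (Fin (1 + 1))) 1,
        Ψ.toFun 1 (ψ (r₀ • (x : EuclideanSpace ℝ (Fin 2)))) =
          ψ (r₁ • (x : EuclideanSpace ℝ (Fin 2)))) ∧
      ∀ (t : ℝ) (y : N), y ∉ ψ '' (ball (0 : EuclideanSpace ℝ (Fin 2)) R \ closedBall 0 r') →
        Ψ.toFun t y = y := by
  haveI : Fact (finrank ℝ (EuclideanSpace ℝ (Fin (1 + 1))) = 1 + 1) := ⟨finrank_euclideanSpace_fin⟩
  -- the radius profile
  set ρ : ℝ → ℝ := fun t => r₀ + (r₁ - r₀) * Real.smoothTransition t with hρ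
  have hρ0 : ρ 0 = r₀ := by simp [hρ, Real.smoothTransition.zero]
  have hρ1 : ρ 1 = r₁ := by simp [hρ, Real.smoothTransition.one]
  have hρbounds : ∀ t, min r₀ r₁ ≤ ρ t ∧ ρ t ≤ max r₀ r₁ := fun t => by
    have hs0 := Real.smoothTransition.nonneg t
    have hs1 := Real.smoothTransition.le_one t
    constructor
    · rcases le_total r₀ r₁ with h | h
      · rw [min_eq_left h]; simp only [hρ]; nlinarith
      · rw [min_eq_right h]; simp only [hρ]; nlinarith
    · rcases le_total r₀ r₁ with h | h
      · rw [max_eq_right h]; simp only [hρ]; nlinarith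
      · rw [max_eq_left h]; simp only [hρ]; nlinarith
  have hρpos : ∀ t, 0 < ρ t := fun t => (lt_min h₀ h₁).trans_le (hρbounds t).1
  have hρc : ContMDiff 𝓘(ℝ, ℝ) 𝓘(ℝ, ℝ) ∞ ρ :=
    (contDiff_const.add (contDiff_const.mul Real.smoothTransition.contDiff)).contMDiff
  -- the isotopy of circles
  have hcoe : ContMDiff (𝓡 1) (𝓡 2) ∞
      ((↑) : sphere (0 : EuclideanSpace ℝ (Fin (1 + 1))) 1 → EuclideanSpace ℝ (Fin 2)) :=
    contMDiff_coe_sphere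
  let F : SmoothIsotopy (𝓡 1) (𝓡 2)
      (fun x : sphere (0 : EuclideanSpace ℝ (Fin (1 + 1))) 1 =>
        ψ (r₀ • (x : EuclideanSpace ℝ (Fin 2))))
      (fun x : sphere (0 : EuclideanSpace ℝ (Fin (1 + 1))) 1 =>
        ψ (r₁ • (x : EuclideanSpace ℝ (Fin 2)))) :=
    { toFun := fun t x => ψ (ρ t • (x : EuclideanSpace ℝ (Fin 2)))
      contMDiff := by
        have h : ContMDiff (𝓘(ℝ, ℝ).prod (𝓡 1)) (𝓡 2) ∞
            (fun p : ℝ × sphere (0 : EuclideanSpace ℝ (Fin (1 + 1))) 1 =>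
              ρ p.1 • (p.2 : EuclideanSpace ℝ (Fin 2))) :=
          (hρc.comp contMDiff_fst).smul (hcoe.comp contMDiff_snd)
        exact hψ.contMDiff.comp h
      isSmoothEmbedding := fun t => isSmoothEmbedding_disc_comp_smul_sphere hψ (hρpos t).ne'
      map_zero := by funext x; simp only [hρ0]
      map_one := by funext x; simp only [hρ1] }
  -- the open annular region and the track
  set O : Set N := ψ '' (ball (0 : EuclideanSpace ℝ (Fin 2)) R \ closedBall 0 r') with hO_def
  have hO : IsOpen O := isOpenMap_disc hψ _ (isOpen_ball.sdiff isClosed_closedBall)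
  have hFO : ∀ t x, F.toFun t x ∈ O := fun t x => by
    refine ⟨ρ t • (x : EuclideanSpace ℝ (Fin 2)), ⟨?_, ?_⟩, rfl⟩
    · rw [mem_ball_zero_iff, norm_smul, Real.norm_of_nonneg (hρpos t).le, norm_eq_of_mem_sphere x,
        mul_one]
      exact (hρbounds t).2.trans_lt (max_lt hR₀ hR₁)
    · rw [mem_closedBall_zero_iff, norm_smul, Real.norm_of_nonneg (hρpos t).le,
        norm_eq_of_mem_sphere x, mul_one, not_le]
      exact (lt_min hr'₀ hr'₁).trans_le (hρbounds t).1
  obtain ⟨Ψ, hΨ, hΨid⟩ := exists_ambientIsotopy_comp_eq_of_subset F hO hFO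
  refine ⟨Ψ, fun x => ?_, fun t y hy => hΨid t y hy⟩
  have h := congr_fun (hΨ 1 ⟨zero_le_one, le_rfl⟩) x
  simp only [Function.comp_apply] at h
  rw [h]
  show ψ (ρ 1 • (x : EuclideanSpace ℝ (Fin 2))) = ψ (r₁ • (x : EuclideanSpace ℝ (Fin 2)))
  rw [hρ1]

/-! ### Annular charts

The same statements for a plane map `ψ` that is only known to be an injective immersion,
smoothly, on an open round annulus `{r_lo < ‖x‖ < r_hi}` — the situation of an annular region of
a surface parametrised through the smooth annulus theorem (`SchoenfliesPlane.exists_annulus`)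
composed with a chart defined on a punctured plane, where no smooth embedding of the WHOLE plane
is available (the inner Jordan domain contains the puncture).  The support of the sweep is now
any open set `O` of the surface supplied by the user and containing `ψ {r' < ‖x‖ < R}`. -/

omit [CompactSpace N] in
/-- **A round circle of an annular chart is a smoothly embedded circle**: if `ψ : ℝ² → N` is
smooth and injective on the open annulus `A = {r_lo < ‖x‖ < r_hi}` with injective differential
there, then for `r_lo < c < r_hi`, `0 < c`, the circle `x ↦ ψ (c • x)` is a smooth embedding
`𝕊¹ → N`. [folklore] -/
theorem isSmoothEmbedding_comp_smul_sphere_of_annulus {ψ : EuclideanSpace ℝ (Fin 2) → N}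
    {rlo rhi : ℝ}
    (hs : ContMDiffOn (𝓡 2) (𝓡 2) ∞ ψ {x | rlo < ‖x‖ ∧ ‖x‖ < rhi})
    (hinj : InjOn ψ {x | rlo < ‖x‖ ∧ ‖x‖ < rhi})
    (himm : ∀ x : EuclideanSpace ℝ (Fin 2), rlo < ‖x‖ → ‖x‖ < rhi →
      Injective (mfderiv (𝓡 2) (𝓡 2) ψ x))
    {c : ℝ} (hc : 0 < c) (hlo : rlo < c) (hhi : c < rhi) :
    Manifold.IsSmoothEmbedding (𝓡 1) (𝓡 2) ∞
      (fun x : sphere (0 : EuclideanSpace ℝ (Fin (1 + 1))) 1 =>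
        ψ (c • (x : EuclideanSpace ℝ (Fin 2)))) := by
  haveI : Fact (finrank ℝ (EuclideanSpace ℝ (Fin (1 + 1))) = 1 + 1) := ⟨finrank_euclideanSpace_fin⟩
  set A : Set (EuclideanSpace ℝ (Fin 2)) := {x | rlo < ‖x‖ ∧ ‖x‖ < rhi} with hA_def
  have hA : IsOpen A :=
    (isOpen_lt continuous_const continuous_norm).inter (isOpen_lt continuous_norm continuous_const)
  set L : EuclideanSpace ℝ (Fin 2) ≃L[ℝ] EuclideanSpace ℝ (Fin 2) :=
    ContinuousLinearEquiv.smulLeft (Units.mk0 c hc.ne') with hL_def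
  have hL : ∀ y : EuclideanSpace ℝ (Fin 2), L y = c • y := fun y => by
    rw [hL_def, ContinuousLinearEquiv.smulLeft_apply_apply, Units.smul_mk0]
  have hcoe : ContMDiff (𝓡 1) (𝓡 2) ∞
      ((↑) : sphere (0 : EuclideanSpace ℝ (Fin (1 + 1))) 1 → EuclideanSpace ℝ (Fin 2)) :=
    contMDiff_coe_sphere
  have hLc : ContMDiff (𝓡 2) (𝓡 2) ∞ (L : EuclideanSpace ℝ (Fin 2) → EuclideanSpace ℝ (Fin 2)) :=
    (L : EuclideanSpace ℝ (Fin 2) →L[ℝ] EuclideanSpace ℝ (Fin 2)).contMDiff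
  -- the circle of radius `c` lies in the annulus
  have hmemA : ∀ x : sphere (0 : EuclideanSpace ℝ (Fin (1 + 1))) 1,
      L (x : EuclideanSpace ℝ (Fin 2)) ∈ A := fun x => by
    rw [hL, hA_def, mem_setOf_eq, norm_smul, Real.norm_of_nonneg hc.le, norm_eq_of_mem_sphere x,
      mul_one]
    exact ⟨hlo, hhi⟩
  have heq : (fun x : sphere (0 : EuclideanSpace ℝ (Fin (1 + 1))) 1 =>
      ψ (c • (x : EuclideanSpace ℝ (Fin 2)))) = ψ ∘ (L ∘ (↑)) := by
    funext x
    simp only [Function.comp_apply, hL]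
  rw [heq]
  have hc' : ContMDiff (𝓡 1) (𝓡 2) ∞ (ψ ∘ (L ∘ (↑)) :
      sphere (0 : EuclideanSpace ℝ (Fin (1 + 1))) 1 → N) :=
    hs.comp_contMDiff (hLc.comp hcoe) hmemA
  refine isSmoothEmbedding_of_injective_of_injective_mfderiv hc' (by exact_mod_cast le_top)
    (fun x y hxy => Subtype.val_injective (L.injective (hinj (hmemA x) (hmemA y) hxy)))
    fun x => ?_
  have h1 : MDifferentiableAt (𝓡 1) (𝓡 2)
      ((↑) : sphere (0 : EuclideanSpace ℝ (Fin (1 + 1))) 1 → EuclideanSpace ℝ (Fin 2)) x :=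
    (hcoe x).mdifferentiableAt (by simp)
  have h2 : MDifferentiableAt (𝓡 2) (𝓡 2) (L : EuclideanSpace ℝ (Fin 2) → EuclideanSpace ℝ (Fin 2))
      (x : EuclideanSpace ℝ (Fin 2)) := (hLc _).mdifferentiableAt (by simp)
  have h12 : MDifferentiableAt (𝓡 1) (𝓡 2)
      (L ∘ (↑) : sphere (0 : EuclideanSpace ℝ (Fin (1 + 1))) 1 → EuclideanSpace ℝ (Fin 2)) x :=
    h2.comp x h1
  have h3 : MDifferentiableAt (𝓡 2) (𝓡 2) ψ (L (x : EuclideanSpace ℝ (Fin 2))) :=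
    ((hs _ (hmemA x)).contMDiffAt (hA.mem_nhds (hmemA x))).mdifferentiableAt (by simp)
  rw [mfderiv_comp x h3 h12, mfderiv_comp x h2 h1, ContinuousLinearEquiv.mfderiv_eq]
  have hinjψ : Injective (mfderiv (𝓡 2) (𝓡 2) ψ (L (x : EuclideanSpace ℝ (Fin 2)))) :=
    himm _ (hmemA x).1 (hmemA x).2
  exact hinjψ.comp (L.injective.comp (mfderiv_coe_sphere_injective (n := 1) x))

/-- **Sweeping one round circle of an annular chart onto another.**  Let `N` be a closed
surface and `ψ : ℝ² → N` smooth and injective with injective differential on the open annulus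
`{r_lo < ‖x‖ < r_hi}`; let `0 < r₀ < R`, `0 < r₁ < R`, `r' < min r₀ r₁`, with
`r_lo ≤ r'` and `R ≤ r_hi`, and let `O ⊆ N` be an open set containing `ψ {r' < ‖x‖ < R}`.
Then there is an ambient isotopy `Ψ` of `N` with `Ψ₁ (ψ (r₀ • x)) = ψ (r₁ • x)` for every unit
vector `x` and `Ψ_t y = y` for all `t` and all `y ∉ O`.  (Isotopy extension with support applied
to the family of round circles `x ↦ ψ (ρ t • x)`, which stays in the annulus.)
[cite: MilnorHCobordism1965, Thm. 5.8 (PDF p. 34)] [cite: HirschDT1976, Ch. 8 §1, Thm. 1.3] -/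
theorem exists_ambientIsotopy_sweep_circle_of_annulus {ψ : EuclideanSpace ℝ (Fin 2) → N}
    {rlo rhi : ℝ}
    (hs : ContMDiffOn (𝓡 2) (𝓡 2) ∞ ψ {x | rlo < ‖x‖ ∧ ‖x‖ < rhi})
    (hinj : InjOn ψ {x | rlo < ‖x‖ ∧ ‖x‖ < rhi})
    (himm : ∀ x : EuclideanSpace ℝ (Fin 2), rlo < ‖x‖ → ‖x‖ < rhi →
      Injective (mfderiv (𝓡 2) (𝓡 2) ψ x))
    {r₀ r₁ R r' : ℝ} (h₀ : 0 < r₀) (h₁ : 0 < r₁) (hR₀ : r₀ < R) (hR₁ : r₁ < R)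
    (hr'₀ : r' < r₀) (hr'₁ : r' < r₁) (hlo : rlo ≤ r') (hhi : R ≤ rhi)
    {O : Set N} (hO : IsOpen O)
    (hψO : ∀ x : EuclideanSpace ℝ (Fin 2), r' < ‖x‖ → ‖x‖ < R → ψ x ∈ O) :
    ∃ Ψ : AmbientIsotopy (𝓡 2) N,
      (∀ x : sphere (0 : EuclideanSpace ℝ (Fin (1 + 1))) 1,
        Ψ.toFun 1 (ψ (r₀ • (x : EuclideanSpace ℝ (Fin 2)))) =
          ψ (r₁ • (x : EuclideanSpace ℝ (Fin 2)))) ∧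
      ∀ (t : ℝ) (y : N), y ∉ O → Ψ.toFun t y = y := by
  haveI : Fact (finrank ℝ (EuclideanSpace ℝ (Fin (1 + 1))) = 1 + 1) := ⟨finrank_euclideanSpace_fin⟩
  -- the radius profile
  set ρ : ℝ → ℝ := fun t => r₀ + (r₁ - r₀) * Real.smoothTransition t with hρ
  have hρ0 : ρ 0 = r₀ := by simp [hρ, Real.smoothTransition.zero]
  have hρ1 : ρ 1 = r₁ := by simp [hρ, Real.smoothTransition.one]
  have hρbounds : ∀ t, min r₀ r₁ ≤ ρ t ∧ ρ t ≤ max r₀ r₁ := fun t => by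
    have hs0 := Real.smoothTransition.nonneg t
    have hs1 := Real.smoothTransition.le_one t
    constructor
    · rcases le_total r₀ r₁ with h | h
      · rw [min_eq_left h]; simp only [hρ]; nlinarith
      · rw [min_eq_right h]; simp only [hρ]; nlinarith
    · rcases le_total r₀ r₁ with h | h
      · rw [max_eq_right h]; simp only [hρ]; nlinarith
      · rw [max_eq_left h]; simp only [hρ]; nlinarith
  have hρpos : ∀ t, 0 < ρ t := fun t => (lt_min h₀ h₁).trans_le (hρbounds t).1
  have hρlo' : ∀ t, r' < ρ t := fun t => (lt_min hr'₀ hr'₁).trans_le (hρbounds t).1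
  have hρhi' : ∀ t, ρ t < R := fun t => (hρbounds t).2.trans_lt (max_lt hR₀ hR₁)
  have hρc : ContMDiff 𝓘(ℝ, ℝ) 𝓘(ℝ, ℝ) ∞ ρ :=
    (contDiff_const.add (contDiff_const.mul Real.smoothTransition.contDiff)).contMDiff
  -- the isotopy of circles
  have hcoe : ContMDiff (𝓡 1) (𝓡 2) ∞
      ((↑) : sphere (0 : EuclideanSpace ℝ (Fin (1 + 1))) 1 → EuclideanSpace ℝ (Fin 2)) :=
    contMDiff_coe_sphere
  have hnorm : ∀ (t : ℝ) (x : sphere (0 : EuclideanSpace ℝ (Fin (1 + 1))) 1),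
      ‖ρ t • (x : EuclideanSpace ℝ (Fin 2))‖ = ρ t := fun t x => by
    rw [norm_smul, Real.norm_of_nonneg (hρpos t).le, norm_eq_of_mem_sphere x, mul_one]
  let F : SmoothIsotopy (𝓡 1) (𝓡 2)
      (fun x : sphere (0 : EuclideanSpace ℝ (Fin (1 + 1))) 1 =>
        ψ (r₀ • (x : EuclideanSpace ℝ (Fin 2))))
      (fun x : sphere (0 : EuclideanSpace ℝ (Fin (1 + 1))) 1 =>
        ψ (r₁ • (x : EuclideanSpace ℝ (Fin 2)))) :=
    { toFun := fun t x => ψ (ρ t • (x : EuclideanSpace ℝ (Fin 2)))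
      contMDiff := by
        have h : ContMDiff (𝓘(ℝ, ℝ).prod (𝓡 1)) (𝓡 2) ∞
            (fun p : ℝ × sphere (0 : EuclideanSpace ℝ (Fin (1 + 1))) 1 =>
              ρ p.1 • (p.2 : EuclideanSpace ℝ (Fin 2))) :=
          (hρc.comp contMDiff_fst).smul (hcoe.comp contMDiff_snd)
        refine hs.comp_contMDiff h fun p => ?_
        simp only [mem_setOf_eq, hnorm]
        exact ⟨hlo.trans_lt (hρlo' p.1), (hρhi' p.1).trans_le hhi⟩
      isSmoothEmbedding := fun t =>
        isSmoothEmbedding_comp_smul_sphere_of_annulus hs hinj himm (hρpos t)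
          (hlo.trans_lt (hρlo' t)) ((hρhi' t).trans_le hhi)
      map_zero := by funext x; simp only [hρ0]
      map_one := by funext x; simp only [hρ1] }
  -- the track lies in `O`
  have hFO : ∀ t x, F.toFun t x ∈ O := fun t x =>
    hψO _ (by rw [hnorm]; exact hρlo' t) (by rw [hnorm]; exact hρhi' t)
  obtain ⟨Ψ, hΨ, hΨid⟩ := exists_ambientIsotopy_comp_eq_of_subset F hO hFO
  refine ⟨Ψ, fun x => ?_, fun t y hy => hΨid t y hy⟩
  have h := congr_fun (hΨ 1 ⟨zero_le_one, le_rfl⟩) x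
  simp only [Function.comp_apply] at h
  rw [h]
  show ψ (ρ 1 • (x : EuclideanSpace ℝ (Fin 2))) = ψ (r₁ • (x : EuclideanSpace ℝ (Fin 2)))
  rw [hρ1]

end SurfaceCircleSweep

end Literature.Topology.FourManifolds

end
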